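import Summits.BirchSwinnertonDyer.Rank1Residual.X9.PrintCertHowardCerts
import Summits.BirchSwinnertonDyer.Rank1Residual.X9.PrintCertRecordsCertifiedX9S4R1
import HarnessLib

/-!
# The Howard frame certificates PASS IN THE KERNEL — slices `S4R1C`, `S4R1D` (records v4): display theorems, census

HONEST FRAMING (cell `bsd-print-x9`, D-0131 (2) print tier): theorems only; no named fact; nothing asserted about any elliptic curve beyond
what the kernel rechecks; no pair is booked and no leaf is closed (`BSDpOnClassX9`, `BSDpOnClassX10b` stay `@[conjecture]`; cruxes J = item 20392,
J₃ = item 21340 stay OPEN). For each slice: `howardScreen_<Slice>` — every rank-`1` record has a Howard frame certificate (`X9/PrintCertHowardCerts.lean`)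
passing `Record.howardCheck` (`X9/PrintCertHoward.lean`: the records-v3 Heegner frame check AND `D` odd AND `h(D)` RECOMPUTED by the kernel as the
number of reduced primitive forms (`Quadratic.BinQF.classNumber`) AND `p ∤ h(D)`), by `decide +kernel`; hence (soundness in `X9/PrintCertHoward.lean`)
for ANY imaginary quadratic `K` with `d_K = c.D` and ANY globally minimal `W / ℚ` with `integralModelInt W = r.intCurve`: `howardFrame_of_mem_<Slice>` —
`K` satisfies the Heegner hypothesis for `N(W)` and for `p`, `|d_K| > 4`, `4N ∣ β² − d_K`, `d_K ≡ 1 (mod 8)` at `p = 3`, `Odd d_K`, `d_K ≠ -3, -4` and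
**`¬ p ∣ NumberField.classNumber K`** (Cox Thm. 7.7(ii) by name: `ClassNumberValues.not_dvd_classNumber_of_discr_eq`) — every `K`-side hypothesis of
`ClassX9.mz26Hypotheses` / of the YZ26 composite of the cell's J-free Howard road, IN THE KERNEL. Census `howardCensus_<Slice>`: list sizes and the
J-screen profile (`v_p(m_K)` vs `t`) of the new frames (each new certificate is also a records-v3 frame with the `n = 1` screen).

References: [Cox2013] §2.A Thm. 2.13, §7.B Thm. 7.7(ii); [MastellaZerman2026] Assumption 2.1, Cor. 4.6; [GrossZagier1986] I §3, V (2.2);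
[Jetchev2008] Conj. 1.1; [GrossLMS1991] §1; [Marcus1977] Ch. 3 Thm. 25.
-/

set_option autoImplicit false

namespace Summit.BirchSwinnertonDyer.Rank1Residual.X9.PrintCert

open WeierstrassCurve Summit.BirchSwinnertonDyer.Rank1Residual.Additive
open Literature.NumberTheory.EllipticCurves (IsImaginaryQuadratic SatisfiesHeegnerHypothesis)

-- `decide +kernel` runs the frame arithmetic AND recomputes the class number `h(D)` (reduced forms, cost `O(|D|)`) for every certificate it
-- visits: raise the recursion depth; elaborate the slices one after the other (memory).
set_option maxRecDepth 100000
set_option Elab.async false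

/-! ## Slice `S4R1C` (82 rank-`1` records; 91 Howard frame certificates = 72 records-v3 certificates with `D` odd, `p ∤ h(D)` + 19 new) -/

/-- Every rank-`1` record of slice `S4R1C` has a Howard frame certificate passing `Record.howardCheck` — in particular `h(D)` recomputed and
`p ∤ h(D)` — IN THE KERNEL. [cite: MastellaZerman2026, Assumption 2.1] [cite: Cox2013, §2.A Thm. 2.13] -/
theorem howardScreen_S4R1C : howardScreen recordsS4R1C (fun r => r.rank == 1) howardCertsS4R1C = true := by
  decide +kernel

/-- Unpacked: a rank-`1` record of slice `S4R1C` has a passing Howard frame certificate in `howardCertsS4R1C`. [cite: MastellaZerman2026, Assumption 2.1] -/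
theorem exists_howardCheck_of_mem_S4R1C {r : Record} (hr : r ∈ recordsS4R1C) (h1 : r.rank = 1) :
    ∃ c ∈ howardCertsS4R1C, r.howardCheck c = true :=
  exists_howardCheck_of_howardScreen howardScreen_S4R1C hr (by simp [h1])

/-- **THE HOWARD FRAME, slice `S4R1C`**: for a rank-`1` record, ANY imaginary quadratic `K` whose discriminant is the certificate's `D` satisfies,
for ANY globally minimal `W` with the record's integral model: the Heegner hypothesis for `N(W)` and for `p`, `|d_K| > 4`, `4N ∣ β² − d_K` (record
conductor), `d_K ≡ 1 (mod 8)` at `p = 3`; `Odd d_K`; `d_K ≠ -3, -4`; and `¬ p ∣ h_K` — IN THE KERNEL. [cite: MastellaZerman2026, Assumption 2.1, Cor. 4.6]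
[cite: Cox2013, §7.B Thm. 7.7(ii)] [cite: GrossLMS1991, §1 (p. 235)] -/
theorem howardFrame_of_mem_S4R1C {r : Record} (hr : r ∈ recordsS4R1C) (h1 : r.rank = 1) {W : WeierstrassCurve ℚ} [W.IsElliptic]
    [W.IsGloballyMinimal] (hI : integralModelInt W = r.intCurve) {K : Type} [Field K] [NumberField K]
    (hK : IsImaginaryQuadratic K) {q : ℕ} (hq : q = r.p) :
    ∃ c ∈ howardCertsS4R1C, r.howardCheck c = true ∧ (NumberField.discr K = c.D →
      (SatisfiesHeegnerHypothesis (W.conductorNorm ℤ) K ∧ SatisfiesHeegnerHypothesis q K ∧ 4 < (NumberField.discr K).natAbs ∧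
        (4 * (r.conductor : ℤ)) ∣ (c.beta : ℤ) ^ 2 - NumberField.discr K ∧ (q = 3 → NumberField.discr K % 8 = 1)) ∧
      Odd (NumberField.discr K) ∧ (NumberField.discr K ≠ -3 ∧ NumberField.discr K ≠ -4) ∧ ¬ q ∣ NumberField.classNumber K) := by
  obtain ⟨c, hc, hh⟩ := exists_howardCheck_of_mem_S4R1C hr h1
  exact ⟨c, hc, hh, fun hd => Record.howardFrame_of_howardCheck hI (certified_S4R1C.check_of_mem hr) hh hK hd hq⟩

/-- KERNEL CENSUS, slice `S4R1C`: `howardCertsS4R1C` has 91 certificates (72 re-used records-v3 frames + 19 new) for the 82 rank-`1`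
records; among the 19 NEW frames `v_p(m_K) = t` on 17, `> t` on 2 (155682w1 at D = -551, 184512w1 at D = -551), `< t` on 0. [cite: Jetchev2008, Conj. 1.1] -/
theorem howardCensus_S4R1C : (howardCertsS4R1C).length = 91 ∧ (howardCertsNewS4R1C).length = 19 ∧
    ((howardCertsNewS4R1C).filter fun c => c.indexVal == c.depth).length = 17 ∧
    ((howardCertsNewS4R1C).filter fun c => decide (c.depth < c.indexVal)).length = 2 ∧
    ((howardCertsNewS4R1C).filter fun c => decide (c.indexVal < c.depth)).length = 0 := by
  refine ⟨?_, ?_, ?_, ?_, ?_⟩ <;> decide +kernel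

/-! ## Slice `S4R1D` (81 rank-`1` records; 96 Howard frame certificates = 74 records-v3 certificates with `D` odd, `p ∤ h(D)` + 22 new) -/

/-- Every rank-`1` record of slice `S4R1D` has a Howard frame certificate passing `Record.howardCheck` — in particular `h(D)` recomputed and
`p ∤ h(D)` — IN THE KERNEL. [cite: MastellaZerman2026, Assumption 2.1] [cite: Cox2013, §2.A Thm. 2.13] -/
theorem howardScreen_S4R1D : howardScreen recordsS4R1D (fun r => r.rank == 1) howardCertsS4R1D = true := by
  decide +kernel

/-- Unpacked: a rank-`1` record of slice `S4R1D` has a passing Howard frame certificate in `howardCertsS4R1D`. [cite: MastellaZerman2026, Assumption 2.1] -/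
theorem exists_howardCheck_of_mem_S4R1D {r : Record} (hr : r ∈ recordsS4R1D) (h1 : r.rank = 1) :
    ∃ c ∈ howardCertsS4R1D, r.howardCheck c = true :=
  exists_howardCheck_of_howardScreen howardScreen_S4R1D hr (by simp [h1])

/-- **THE HOWARD FRAME, slice `S4R1D`**: for a rank-`1` record, ANY imaginary quadratic `K` whose discriminant is the certificate's `D` satisfies,
for ANY globally minimal `W` with the record's integral model: the Heegner hypothesis for `N(W)` and for `p`, `|d_K| > 4`, `4N ∣ β² − d_K` (record
conductor), `d_K ≡ 1 (mod 8)` at `p = 3`; `Odd d_K`; `d_K ≠ -3, -4`; and `¬ p ∣ h_K` — IN THE KERNEL. [cite: MastellaZerman2026, Assumption 2.1, Cor. 4.6]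
[cite: Cox2013, §7.B Thm. 7.7(ii)] [cite: GrossLMS1991, §1 (p. 235)] -/
theorem howardFrame_of_mem_S4R1D {r : Record} (hr : r ∈ recordsS4R1D) (h1 : r.rank = 1) {W : WeierstrassCurve ℚ} [W.IsElliptic]
    [W.IsGloballyMinimal] (hI : integralModelInt W = r.intCurve) {K : Type} [Field K] [NumberField K]
    (hK : IsImaginaryQuadratic K) {q : ℕ} (hq : q = r.p) :
    ∃ c ∈ howardCertsS4R1D, r.howardCheck c = true ∧ (NumberField.discr K = c.D →
      (SatisfiesHeegnerHypothesis (W.conductorNorm ℤ) K ∧ SatisfiesHeegnerHypothesis q K ∧ 4 < (NumberField.discr K).natAbs ∧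
        (4 * (r.conductor : ℤ)) ∣ (c.beta : ℤ) ^ 2 - NumberField.discr K ∧ (q = 3 → NumberField.discr K % 8 = 1)) ∧
      Odd (NumberField.discr K) ∧ (NumberField.discr K ≠ -3 ∧ NumberField.discr K ≠ -4) ∧ ¬ q ∣ NumberField.classNumber K) := by
  obtain ⟨c, hc, hh⟩ := exists_howardCheck_of_mem_S4R1D hr h1
  exact ⟨c, hc, hh, fun hd => Record.howardFrame_of_howardCheck hI (certified_S4R1D.check_of_mem hr) hh hK hd hq⟩

/-- KERNEL CENSUS, slice `S4R1D`: `howardCertsS4R1D` has 96 certificates (74 re-used records-v3 frames + 22 new) for the 81 rank-`1`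
records; among the 22 NEW frames `v_p(m_K) = t` on 20, `> t` on 2 (274752bk1 at D = -311, 283024s1 at D = -559), `< t` on 0. [cite: Jetchev2008, Conj. 1.1] -/
theorem howardCensus_S4R1D : (howardCertsS4R1D).length = 96 ∧ (howardCertsNewS4R1D).length = 22 ∧
    ((howardCertsNewS4R1D).filter fun c => c.indexVal == c.depth).length = 20 ∧
    ((howardCertsNewS4R1D).filter fun c => decide (c.depth < c.indexVal)).length = 2 ∧
    ((howardCertsNewS4R1D).filter fun c => decide (c.indexVal < c.depth)).length = 0 := by
  refine ⟨?_, ?_, ?_, ?_, ?_⟩ <;> decide +kernel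

end Summit.BirchSwinnertonDyer.Rank1Residual.X9.PrintCert
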